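import Summits.QuantumFields.BalabanUV.T4Continuum.Support.NE7LawLevelWindow
import Literature.MathematicalPhysics.QuantumFieldTheory.Balaban1983to89.T4MeanChannel

/-!
# NE7, ROAD P4 (law-level): NODE Q.old's PRODUCER — the second moment along the chain's REVERSE FILTRATION
# (orthogonal layers, one backward RG step each) ⇒ the one-run pure-average L¹ rate `PureAverageL1Rate`

(Cell `pub-balaban`, sub-cell `t4`, binder row NE7 = node U5, co-owner #4 `b2b-balaban-t4-ne7-p4`, gen 2; skeleton
`HOME/t4/skeletons/NE7-t4-ne7-p4.md` §2 NODE Q (v1.7).  Imports the road's `NE7LawLevelWindow` (p208569: the shape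
`PureAverageL1Rate` and `oldResamplingSmall_of_pureAverageL1Rate`) and row NE1′'s [folklore] module `T4MeanChannel`
(Doob–Lévy increments `incr μ F f i` along an antitone filtration, their orthogonality (K14r) and the variance identity
(K14u) `integral_sq_condExp_sub_eq_sum`), both BY NAME.)

HONEST FRAMING (T4-DAG PAGE 1).  Rung (B)+1 on ONE FIXED finite four-torus, CONDITIONAL on `BetaPertH` and the nine
spine estimates (0/9 proved); NOT infinite volume, NOT a mass gap, NOT the Clay problem.  NE7 is NOT PRINTED and NOT
proved here; every `def … : Prop` / `structure` below is a HYPOTHESIS SHAPE over plain probabilistic data, every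
theorem is [folklore] measure theory ∕ bookkeeping, sorry-free; no statement of the audited series
([Balaban1988Convergent], [Balaban1989LargeFieldI], [Balaban1989LargeFieldII]) is asserted or used; NOT summit
progress.

WHAT THIS FILE DOES (the assigned technique «coupling + Cauchy–Schwarz against second moments», made precise for
NODE Q.old).  `NE7LawLevelWindow` typed Q.old as the ONE-RUN shape `PureAverageL1Rate Ω P F Φp s`: on run `K`'s chain
the TRUE dressing `F K os` and the PURE-AVERAGE dressing `Φp K os` of the time-`(K − n₀)` state differ in `L¹(P K)` by
`≤ C·s_K`.  Here that shape is PRODUCED from data one level down (`OldLayerDatum`, §2):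
* a finite set of OLD AGES `n` and, per age, a real summand `S n` (DICTIONARY: the first-order, block-diluted effect on
  the unit observable of the resampling kicks of age `n`, i.e. of the ℝ-step at level `K − n`) with a pointwise
  TAYLOR REMAINDER budget `|F − Φp − Σ_n S n| ≤ rem` (field `taylor`; DICTIONARY: dilution geometry (k5) squared × counts);
* per age, an ANTITONE family of sub-σ-algebras `𝓕 n 0 ⊇ 𝓕 n 1 ⊇ … ⊇ 𝓕 n (depth n)` (DICTIONARY: `𝓕 n j` = the future
  of the chain from time `K − n + j` on — by the Markov property conditioning on it is conditioning on the level-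
  `(K − n + j)` state; `depth n = n` reaches the unit scale) and THREE second-moment budgets:
  `noise`  — `∫ (S n − P[S n | 𝓕 n 0])² ≤ vNoise n`   (resampling NOISE: DICTIONARY = conditional independence of the
             fibre resamplings of distinct components given the pre-resampling state, [dict] over (0.3)∕(0.5) p. 176,
             × dilution² × count);
  `layer`  — `∫ (incr P (𝓕 n) (S n) j)² ≤ vLayer n j` for `j < depth n`   (ONE BACKWARD RG STEP's conditional variance
             of the conditional mean of `S n` given the level-`(K − n + j)` state: DICTIONARY = a Poincaré ∕
             Brascamp–Lieb variance bound for ONE T-step fibre law on its convex small-field domain + the large-field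
             events of ONE step, × the CURVATURE-LIPSCHITZ constants (QL) of the components' conditional mean kicks
             w.r.t. the coarser layer, × counts — ONE-RUN, ONE-STEP inputs, NOT PRINTED as statements);
  `mean`   — `∫ (P[S n | 𝓕 n (depth n)])² ≤ mMean n`   (the squared CONDITIONAL MEAN given the unit-scale data =
             the skeleton's Q.old-c: environment-averaged transported mean kick of age `n` ≲ L^{−(1+ε)n} relative,
             ONE-RUN, NOT PRINTED);
* the EXACT second-moment identity (§1 `integral_sq_eq_noise_add_layers_add_mean`):
  `∫ (S n)² = ∫ (S n − P[S n|𝓕 n 0])² + Σ_{j<depth n} ∫ (incr_j)² + ∫ (P[S n|𝓕 n (depth n)])²`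
  — orthogonality of the Doob–Lévy increments along the reverse filtration, NO decorrelation hypothesis on the law —
  and Cauchy–Schwarz `∫|S n| ≤ √∫(S n)²` (§1) give `∫ |F − Φp| ≤ rem + Σ_n √(vNoise n + Σ_j vLayer n j + mMean n)`
  (§2 `integral_abs_sub_le_total`), whence `PureAverageL1Rate` (§3 `pureAverageL1Rate_of_oldLayerBudget`) and, with a
  geometric age profile, the window form `total ≤ rem + c·q^{n₀}/(1 − q)` (§2 `total_le_of_geometric`).
WHY THIS CUT (recorded in the skeleton v1.7, CORRECTING v1.6 §2 Q.old): the ℓ¹ count of old resamplings under a unit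
loop DIVERGES (`Σ_n L^{4n}e^{−p₀(g_{K−n})}·L^{−3n}`), so smallness can only come from cancellations; the kicks of distinct
components are conditionally independent given the pre-resampling state ONLY in their resampling noise — their
environment-driven conditional MEANS are correlated through the coarser layers; taking the second moment along the
chain's own reverse filtration makes those layers ORTHOGONAL (this file), so that every remaining input is a ONE-STEP
conditional variance or a ONE-COMPONENT Lipschitz ∕ centring statement, and NO non-perturbative correlation decay of the
level-`k` measure is invoked.  None of those inputs is proved or printed; they are the binders of `OldLayerDatum`.
-/

noncomputable section

open MeasureTheory Finset
open scoped BigOperators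

namespace Summit.QuantumFields.BalabanUV.T4Continuum.NE7LawLevel

open Literature.MathematicalPhysics.QuantumFieldTheory.Balaban1983to89
open Literature.MathematicalPhysics.QuantumFieldTheory.Balaban1983to89.T4MeanChannel

/-! ## §1 Second-moment tools: Cauchy–Schwarz in L¹ ∕ L² form and the layer identity -/

section SecondMoment

variable {Ω : Type*} {mΩ : MeasurableSpace Ω} {μ : Measure Ω}

/-- Cauchy–Schwarz on a probability space, squared form: `(∫|S|)² ≤ ∫ S²` for a bounded a.e.-strongly measurable `S`
(from `0 ≤ ∫ (|S| − ∫|S|)²`). [folklore] -/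
theorem sq_integral_abs_le_integral_sq [IsProbabilityMeasure μ] {S : Ω → ℝ} (hSm : AEStronglyMeasurable S μ)
    {B : ℝ} (hSb : ∀ ω, |S ω| ≤ B) : (∫ ω, |S ω| ∂μ) ^ 2 ≤ ∫ ω, S ω ^ 2 ∂μ := by
  have hSi : Integrable S μ := integrable_of_ae_abs_le hSm (ae_of_all μ hSb)
  have hSa : Integrable (fun ω => |S ω|) μ := hSi.abs
  have hS2 : Integrable (fun ω => S ω ^ 2) μ := integrable_sq_of_ae_abs_le hSm (ae_of_all μ hSb)
  have hnn : 0 ≤ ∫ ω, (|S ω| - ∫ ω', |S ω'| ∂μ) ^ 2 ∂μ := integral_nonneg fun ω => sq_nonneg _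
  have heq : (fun ω => (|S ω| - ∫ ω', |S ω'| ∂μ) ^ 2) =
      fun ω => (S ω ^ 2 - 2 * (∫ ω', |S ω'| ∂μ) * |S ω|) + (∫ ω', |S ω'| ∂μ) ^ 2 := by
    funext ω; rw [sub_sq, sq_abs]; ring
  have hF : Integrable (fun ω => S ω ^ 2 - 2 * (∫ ω', |S ω'| ∂μ) * |S ω|) μ := hS2.sub (hSa.const_mul _)
  have hF' : Integrable (fun ω => 2 * (∫ ω', |S ω'| ∂μ) * |S ω|) μ := hSa.const_mul _
  have hG : Integrable (fun _ : Ω => (∫ ω', |S ω'| ∂μ) ^ 2) μ := integrable_const _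
  rw [heq, integral_add hF hG, integral_sub hS2 hF', integral_const_mul, integral_const, smul_eq_mul,
    probReal_univ, one_mul] at hnn
  nlinarith [hnn]

/-- Cauchy–Schwarz on a probability space: `∫|S| ≤ √(∫ S²)`. [folklore] -/
theorem integral_abs_le_sqrt_integral_sq [IsProbabilityMeasure μ] {S : Ω → ℝ} (hSm : AEStronglyMeasurable S μ)
    {B : ℝ} (hSb : ∀ ω, |S ω| ≤ B) : ∫ ω, |S ω| ∂μ ≤ Real.sqrt (∫ ω, S ω ^ 2 ∂μ) := by
  have h := sq_integral_abs_le_integral_sq hSm hSb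
  have h0 : 0 ≤ ∫ ω, |S ω| ∂μ := integral_nonneg fun ω => abs_nonneg _
  calc ∫ ω, |S ω| ∂μ = Real.sqrt ((∫ ω, |S ω| ∂μ) ^ 2) := (Real.sqrt_sq h0).symm
    _ ≤ Real.sqrt (∫ ω, S ω ^ 2 ∂μ) := Real.sqrt_le_sqrt h

/-- ONE-STEP PYTHAGORAS: for a member `F j` of a family of sub-σ-algebras and a bounded measurable `S`,
`∫ S² = ∫ (S − μ[S|F j])² + ∫ (μ[S|F j])²` (the cross term vanishes through the mean channel). [folklore] -/
theorem integral_sq_eq_integral_sq_sub_condExp_add [IsFiniteMeasure μ] {F : ℕ → MeasurableSpace Ω}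
    (hFle : ∀ j, F j ≤ mΩ) {S : Ω → ℝ} (hSm : AEStronglyMeasurable S μ) {B : ℝ} (hSb : ∀ ω, |S ω| ≤ B) (j : ℕ) :
    ∫ ω, S ω ^ 2 ∂μ = ∫ ω, (S ω - μ[S|F j] ω) ^ 2 ∂μ + ∫ ω, (μ[S|F j]) ω ^ 2 ∂μ := by
  haveI : SigmaFinite (μ.trim (hFle j)) := inferInstance
  have hSi : Integrable S μ := integrable_of_ae_abs_le hSm (ae_of_all μ hSb)
  have hEb : ∀ᵐ ω ∂μ, |μ[S|F j] ω| ≤ B := ae_abs_condExp_le hSb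
  have hEi : Integrable (μ[S|F j]) μ := integrable_condExp
  have hEm : AEStronglyMeasurable (μ[S|F j]) μ := hEi.aestronglyMeasurable
  have hS2 : Integrable (fun ω => S ω ^ 2) μ := integrable_sq_of_ae_abs_le hSm (ae_of_all μ hSb)
  have hE2 : Integrable (fun ω => μ[S|F j] ω ^ 2) μ := integrable_sq_of_ae_abs_le hEm hEb
  have hES : Integrable (fun ω => μ[S|F j] ω * S ω) μ :=
    hSi.bdd_mul hEm (hEb.mono fun ω h => by rw [Real.norm_eq_abs]; exact h)
  -- the mean channel: `∫ μ[S|F j]·S = ∫ μ[S|F j]·μ[S|F j]`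
  have hch : ∫ ω, μ[S|F j] ω * S ω ∂μ = ∫ ω, μ[S|F j] ω ^ 2 ∂μ := by
    rw [integral_mul_eq_integral_mul_condExp (hFle j) stronglyMeasurable_condExp hSi hES]
    exact integral_congr_ae (ae_of_all μ fun ω => (sq (μ[S|F j] ω)).symm)
  have heq : (fun ω => (S ω - μ[S|F j] ω) ^ 2) =
      fun ω => (S ω ^ 2 - 2 * (μ[S|F j] ω * S ω)) + μ[S|F j] ω ^ 2 := by
    funext ω; ring
  have hA : Integrable (fun ω => S ω ^ 2 - 2 * (μ[S|F j] ω * S ω)) μ := hS2.sub (hES.const_mul 2)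
  have hA' : Integrable (fun ω => 2 * (μ[S|F j] ω * S ω)) μ := hES.const_mul 2
  rw [heq, integral_add hA hE2, integral_sub hS2 hA', integral_const_mul, hch]
  ring

/-- MEAN-PART PYTHAGORAS along an antitone filtration: for bounded `f`,
`∫ (μ[f|F j])² = ∫ (μ[f|F j] − μ[f|F (j+n)])² + ∫ (μ[f|F (j+n)])²`. [folklore] -/
theorem integral_sq_condExp_eq_sq_sub_add_sq [IsFiniteMeasure μ] {F : ℕ → MeasurableSpace Ω} (hF : Antitone F)
    (hFle : ∀ j, F j ≤ mΩ) {f : Ω → ℝ} {R : ℝ} (hf : ∀ ω, |f ω| ≤ R) (j n : ℕ) :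
    ∫ ω, (μ[f|F j]) ω ^ 2 ∂μ =
      ∫ ω, (μ[f|F j] ω - μ[f|F (j + n)] ω) ^ 2 ∂μ + ∫ ω, (μ[f|F (j + n)]) ω ^ 2 ∂μ := by
  haveI : SigmaFinite (μ.trim (hFle j)) := inferInstance
  haveI : SigmaFinite (μ.trim (hFle (j + n))) := inferInstance
  set E := μ[f|F j] with hE
  set G := μ[f|F (j + n)] with hG
  have hEb : ∀ᵐ ω ∂μ, |E ω| ≤ R := ae_abs_condExp_le hf
  have hGb : ∀ᵐ ω ∂μ, |G ω| ≤ R := ae_abs_condExp_le hf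
  have hEm : AEStronglyMeasurable E μ := (stronglyMeasurable_condExp.mono (hFle j)).aestronglyMeasurable
  have hGsm : StronglyMeasurable[F (j + n)] G := stronglyMeasurable_condExp
  have hGm : AEStronglyMeasurable G μ := (hGsm.mono (hFle (j + n))).aestronglyMeasurable
  have hEi : Integrable E μ := integrable_condExp
  have hGi : Integrable G μ := integrable_condExp
  have hE2 : Integrable (fun ω => E ω ^ 2) μ := integrable_sq_of_ae_abs_le hEm hEb
  have hG2 : Integrable (fun ω => G ω ^ 2) μ := integrable_sq_of_ae_abs_le hGm hGb
  have hGE : Integrable (fun ω => G ω * E ω) μ :=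
    hEi.bdd_mul hGm (hGb.mono fun ω h => by rw [Real.norm_eq_abs]; exact h)
  have hGG : Integrable (fun ω => G ω * G ω) μ := hG2.congr (ae_of_all μ fun ω => sq (G ω))
  have hGD : Integrable (fun ω => G ω * (E ω - G ω)) μ :=
    (hGE.sub hGG).congr (ae_of_all μ fun ω => by simp only [Pi.sub_apply]; ring)
  -- tower: μ[E − G | F (j+n)] = 0 a.e.
  have htow : μ[(fun ω => E ω - G ω) | F (j + n)] =ᵐ[μ] 0 := by
    have h1 : μ[E | F (j + n)] =ᵐ[μ] G := condExp_condExp_of_le (hF (Nat.le_add_right j n)) (hFle j)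
    have h2 : μ[G | F (j + n)] = G := condExp_of_stronglyMeasurable (hFle (j + n)) hGsm hGi
    have h3 : μ[(fun ω => E ω - G ω) | F (j + n)] =ᵐ[μ] μ[E | F (j + n)] - μ[G | F (j + n)] :=
      condExp_sub hEi hGi (F (j + n))
    filter_upwards [h3, h1] with ω h3ω h1ω
    rw [h3ω, Pi.sub_apply, h1ω, h2, Pi.zero_apply, sub_self]
  have hcross : ∫ ω, G ω * (E ω - G ω) ∂μ = 0 :=
    integral_mul_eq_zero_of_condExp_ae_eq_zero (hFle (j + n)) hGsm (hEi.sub hGi) hGD htow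
  have heq : (fun ω => E ω ^ 2) = fun ω => ((E ω - G ω) ^ 2 + 2 * (G ω * (E ω - G ω))) + G ω ^ 2 := by
    funext ω; ring
  have hD2 : Integrable (fun ω => (E ω - G ω) ^ 2) μ :=
    integrable_sq_of_ae_abs_le (hEm.sub hGm) (bu := R + R) (by
      filter_upwards [hEb, hGb] with ω h1 h2
      exact (abs_sub _ _).trans (add_le_add h1 h2))
  have hX : Integrable (fun ω => (E ω - G ω) ^ 2 + 2 * (G ω * (E ω - G ω))) μ := hD2.add (hGD.const_mul 2)
  have hY : Integrable (fun ω => 2 * (G ω * (E ω - G ω))) μ := hGD.const_mul 2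
  rw [heq, integral_add hX hG2, integral_add hD2 hY, integral_const_mul, hcross, mul_zero, add_zero]

/-- **THE LAYER IDENTITY (exact).**  For an antitone filtration `F`, a bounded measurable `S` and a depth `J`:
`∫ S² = ∫ (S − μ[S|F 0])² + Σ_{j<J} ∫ (incr μ F S j)² + ∫ (μ[S|F J])²` — resampling noise + orthogonal layers + the
squared conditional mean at depth `J`.  No hypothesis on the law beyond finiteness. [folklore] -/
theorem integral_sq_eq_noise_add_layers_add_mean [IsFiniteMeasure μ] {F : ℕ → MeasurableSpace Ω} (hF : Antitone F)
    (hFle : ∀ j, F j ≤ mΩ) {S : Ω → ℝ} (hSm : AEStronglyMeasurable S μ) {B : ℝ} (hSb : ∀ ω, |S ω| ≤ B) (J : ℕ) :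
    ∫ ω, S ω ^ 2 ∂μ = ∫ ω, (S ω - μ[S|F 0] ω) ^ 2 ∂μ + ∑ j ∈ range J, ∫ ω, incr μ F S j ω ^ 2 ∂μ +
      ∫ ω, (μ[S|F J]) ω ^ 2 ∂μ := by
  rw [integral_sq_eq_integral_sq_sub_condExp_add hFle hSm hSb 0,
    integral_sq_condExp_eq_sq_sub_add_sq hF hFle hSb 0 J, integral_sq_condExp_sub_eq_sum hF hFle hSb 0 J]
  simp only [zero_add, add_assoc]

/-- **FROM LAYER BUDGETS TO L¹** (probability space): budgets for the noise, the `J` layers and the depth-`J` mean give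
`∫|S| ≤ √(vNoise + Σ_{j<J} vLayer j + mMean)`. [folklore] -/
theorem integral_abs_le_sqrt_of_layerBudget [IsProbabilityMeasure μ] {F : ℕ → MeasurableSpace Ω} (hF : Antitone F)
    (hFle : ∀ j, F j ≤ mΩ) {S : Ω → ℝ} (hSm : AEStronglyMeasurable S μ) {B : ℝ} (hSb : ∀ ω, |S ω| ≤ B) (J : ℕ)
    {vNoise mMean : ℝ} {vLayer : ℕ → ℝ} (hnoise : ∫ ω, (S ω - μ[S|F 0] ω) ^ 2 ∂μ ≤ vNoise)
    (hlayer : ∀ j < J, ∫ ω, incr μ F S j ω ^ 2 ∂μ ≤ vLayer j) (hmean : ∫ ω, (μ[S|F J]) ω ^ 2 ∂μ ≤ mMean) :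
    ∫ ω, |S ω| ∂μ ≤ Real.sqrt (vNoise + ∑ j ∈ range J, vLayer j + mMean) := by
  refine (integral_abs_le_sqrt_integral_sq hSm hSb).trans (Real.sqrt_le_sqrt ?_)
  rw [integral_sq_eq_noise_add_layers_add_mean hF hFle hSm hSb J]
  exact add_le_add (add_le_add hnoise (sum_le_sum fun j hj => hlayer j (mem_range.mp hj))) hmean

end SecondMoment

/-! ## §2 The one-run LAYER DATUM of NODE Q.old (hypothesis shape over plain data) -/

section Datum

variable {Ω : Type*} [MeasurableSpace Ω]

/-- **NODE Q.old's PRODUCER, ONE RUN, ONE LEVEL `K`, ONE STRING (hypothesis SHAPE; nothing of it is printed or proved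
for Bałaban's chain).**  On the probability space `(Ω, P)` realising run `K`'s chain, with the true dressing `F` and
the pure-average dressing `Φp`: a finite set `ages` of old ages; per age `n` a bounded measurable first-order summand
`S n` (the block-diluted effect of the age-`n` resampling kicks), an antitone family `𝓕 n` of sub-σ-algebras (the
chain's future from time `K − n + j`), a depth; the TAYLOR remainder budget `taylor`; and the three second-moment
budgets `noise` (resampling noise, conditionally independent across components), `layer` (ONE backward RG step's
conditional variance, `j < depth n`), `mean` (squared conditional mean at the depth = Q.old-c).  See the module header
for the dictionary and the class of each binder. [folklore] -/
structure OldLayerDatum (P : Measure Ω) (F Φp : Ω → ℝ) where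
  /-- the old ages present at this level (a subset of `[n₀(K), K]`) -/
  ages : Finset ℕ
  /-- first-order summand of age `n` -/
  S : ℕ → Ω → ℝ
  /-- reverse filtration for age `n`: `𝓕 n j` = the chain's future from time `K − n + j` -/
  𝓕 : ℕ → ℕ → MeasurableSpace Ω
  /-- number of layers used for age `n` (`= n` reaches the unit scale) -/
  depth : ℕ → ℕ
  /-- a pointwise bound of `S n` -/
  bound : ℕ → ℝ
  /-- Taylor (second-order) remainder budget -/
  rem : ℝ
  /-- resampling-noise variance budget of age `n` -/
  vNoise : ℕ → ℝ
  /-- layer-`j` conditional-variance budget of age `n` -/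
  vLayer : ℕ → ℕ → ℝ
  /-- squared conditional-mean budget of age `n` at depth `depth n` -/
  mMean : ℕ → ℝ
  S_meas : ∀ n, Measurable (S n)
  S_bdd : ∀ n ω, |S n ω| ≤ bound n
  𝓕_le : ∀ n j, 𝓕 n j ≤ ‹MeasurableSpace Ω›
  𝓕_anti : ∀ n, Antitone (𝓕 n)
  taylor : ∀ ω, |F ω - Φp ω - ∑ n ∈ ages, S n ω| ≤ rem
  noise : ∀ n ∈ ages, ∫ ω, (S n ω - P[S n|𝓕 n 0] ω) ^ 2 ∂P ≤ vNoise n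
  layer : ∀ n ∈ ages, ∀ j < depth n, ∫ ω, incr P (𝓕 n) (S n) j ω ^ 2 ∂P ≤ vLayer n j
  mean : ∀ n ∈ ages, ∫ ω, (P[S n|𝓕 n (depth n)]) ω ^ 2 ∂P ≤ mMean n

variable {P : Measure Ω} {F Φp : Ω → ℝ}

/-- The age-`n` bracket `vNoise n + Σ_{j<depth n} vLayer n j + mMean n`. -/
def OldLayerDatum.bracket (D : OldLayerDatum P F Φp) (n : ℕ) : ℝ :=
  D.vNoise n + ∑ j ∈ range (D.depth n), D.vLayer n j + D.mMean n

/-- The TOTAL of the datum: `rem + Σ_{n∈ages} √(bracket n)`. -/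
def OldLayerDatum.total (D : OldLayerDatum P F Φp) : ℝ :=
  D.rem + ∑ n ∈ D.ages, Real.sqrt (D.bracket n)

/-- Each first-order summand is small in L¹: `∫|S n| ≤ √(bracket n)`. [folklore] -/
theorem OldLayerDatum.integral_abs_S_le [IsProbabilityMeasure P] (D : OldLayerDatum P F Φp) {n : ℕ}
    (hn : n ∈ D.ages) : ∫ ω, |D.S n ω| ∂P ≤ Real.sqrt (D.bracket n) :=
  integral_abs_le_sqrt_of_layerBudget (D.𝓕_anti n) (D.𝓕_le n) (D.S_meas n).aestronglyMeasurable (D.S_bdd n)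
    (D.depth n) (D.noise n hn) (D.layer n hn) (D.mean n hn)

/-- **NODE Q.old ASSEMBLED (one run, one level, one string):** `∫ |F − Φp| dP ≤ total` — Taylor remainder plus, per
old age, Cauchy–Schwarz against the exact layer decomposition of the second moment. [folklore] -/
theorem integral_abs_sub_le_total [IsProbabilityMeasure P] (hFm : Measurable F) (hΦm : Measurable Φp)
    (hFb : ∀ ω, |F ω| ≤ 1) (hΦb : ∀ ω, |Φp ω| ≤ 1) (D : OldLayerDatum P F Φp) :
    ∫ ω, |F ω - Φp ω| ∂P ≤ D.total := by
  have hSi : ∀ n ∈ D.ages, Integrable (D.S n) P := fun n _ =>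
    T4VarianceMatching.integrable_of_abs_le P (D.S_meas n) (D.S_bdd n)
  have hsum : Integrable (fun ω => ∑ n ∈ D.ages, D.S n ω) P := integrable_finsetSum _ hSi
  have hFΦ : Integrable (fun ω => F ω - Φp ω) P :=
    T4VarianceMatching.integrable_of_abs_le P (hFm.sub hΦm) (B := 2) fun ω =>
      (abs_sub _ _).trans (by linarith [hFb ω, hΦb ω])
  have hpt : ∀ ω, |F ω - Φp ω| ≤ |F ω - Φp ω - ∑ n ∈ D.ages, D.S n ω| + ∑ n ∈ D.ages, |D.S n ω| := fun ω => by
    have h := abs_add_le (F ω - Φp ω - ∑ n ∈ D.ages, D.S n ω) (∑ n ∈ D.ages, D.S n ω)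
    rw [sub_add_cancel] at h
    exact h.trans (add_le_add le_rfl (abs_sum_le_sum_abs _ _))
  have hR : Integrable (fun ω => |F ω - Φp ω - ∑ n ∈ D.ages, D.S n ω|) P := (hFΦ.sub hsum).abs
  have hA : Integrable (fun ω => ∑ n ∈ D.ages, |D.S n ω|) P := integrable_finsetSum _ fun n hn => (hSi n hn).abs
  calc ∫ ω, |F ω - Φp ω| ∂P ≤ ∫ ω, |F ω - Φp ω - ∑ n ∈ D.ages, D.S n ω| + ∑ n ∈ D.ages, |D.S n ω| ∂P :=
        integral_mono hFΦ.abs (hR.add hA) hpt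
    _ = ∫ ω, |F ω - Φp ω - ∑ n ∈ D.ages, D.S n ω| ∂P + ∑ n ∈ D.ages, ∫ ω, |D.S n ω| ∂P := by
        rw [integral_add hR hA, integral_finsetSum _ fun n hn => (hSi n hn).abs]
    _ ≤ D.rem + ∑ n ∈ D.ages, Real.sqrt (D.bracket n) := by
        refine add_le_add ?_ (sum_le_sum fun n hn => D.integral_abs_S_le hn)
        calc ∫ ω, |F ω - Φp ω - ∑ n ∈ D.ages, D.S n ω| ∂P ≤ ∫ _, D.rem ∂P :=
            integral_mono hR (integrable_const _) D.taylor
          _ = D.rem := by rw [integral_const, smul_eq_mul, probReal_univ, one_mul]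

/-- **THE WINDOW FORM (geometric age profile).**  If every old age is `≥ n₀` and the age-`n` bracket is at most
`(c·qⁿ)²` with `0 ≤ c`, `0 ≤ q < 1`, then `total ≤ rem + c·q^{n₀}/(1 − q)` — the summable-in-`K` window rate once
`n₀(K) ≥ a·log K` with `q^{a} < e^{-1}`-type arithmetic (not done here). [folklore] -/
theorem OldLayerDatum.total_le_of_geometric (D : OldLayerDatum P F Φp) {n₀ : ℕ} {c q : ℝ} (hc : 0 ≤ c)
    (hq0 : 0 ≤ q) (hq1 : q < 1) (hages : ∀ n ∈ D.ages, n₀ ≤ n)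
    (hbr : ∀ n ∈ D.ages, D.bracket n ≤ (c * q ^ n) ^ 2) : D.total ≤ D.rem + c * q ^ n₀ / (1 - q) := by
  unfold OldLayerDatum.total
  refine add_le_add le_rfl ?_
  have h1 : ∑ n ∈ D.ages, Real.sqrt (D.bracket n) ≤ ∑ n ∈ D.ages, c * q ^ n :=
    sum_le_sum fun n hn => by
      calc Real.sqrt (D.bracket n) ≤ Real.sqrt ((c * q ^ n) ^ 2) := Real.sqrt_le_sqrt (hbr n hn)
        _ = c * q ^ n := Real.sqrt_sq (mul_nonneg hc (pow_nonneg hq0 n))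
  refine h1.trans ?_
  -- compare with the geometric tail over `Ico n₀ (n₀ + m)` for `m` large enough to contain `ages`
  obtain ⟨m, hm⟩ : ∃ m, ∀ n ∈ D.ages, n < n₀ + m := by
    refine ⟨D.ages.sup id + 1, fun n hn => ?_⟩
    have : n ≤ D.ages.sup id := le_sup (f := id) hn
    omega
  have hsub : D.ages ⊆ Ico n₀ (n₀ + m) := fun n hn => mem_Ico.mpr ⟨hages n hn, hm n hn⟩
  calc ∑ n ∈ D.ages, c * q ^ n ≤ ∑ n ∈ Ico n₀ (n₀ + m), c * q ^ n :=
        sum_le_sum_of_subset_of_nonneg hsub fun n _ _ => mul_nonneg hc (pow_nonneg hq0 n)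
    _ = c * ∑ n ∈ Ico n₀ (n₀ + m), q ^ n := by rw [mul_sum]
    _ ≤ c * (q ^ n₀ / (1 - q)) := mul_le_mul_of_nonneg_left (geom_sum_Ico_le_of_lt_one hq0 hq1) hc
    _ = c * q ^ n₀ / (1 - q) := mul_div_assoc' c _ _

end Datum

/-! ## §3 The per-`K` budget shape and the producer of `PureAverageL1Rate` -/

section Producer

variable {O : Type*}

/-- **OLD-LAYER BUDGET (ONE-RUN hypothesis shape, NOT PRINTED):** for every string `os` there is `C ≥ 0` such that for
every `K` the two dressings are measurable and bounded by `1`, `0 ≤ s K`, and run `K` carries an `OldLayerDatum` with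
`total ≤ C · s_K`.  Its binders (per `K`): the fields of `OldLayerDatum` — see §2 and the module header. [folklore] -/
def OldLayerBudget (Ω : ℕ → Type*) [∀ K, MeasurableSpace (Ω K)] (P : ∀ K, Measure (Ω K))
    (F Φp : ∀ K, List O → Ω K → ℝ) (s : ℕ → ℝ) : Prop :=
  ∀ os, ∃ C : ℝ, 0 ≤ C ∧ ∀ K, Measurable (F K os) ∧ Measurable (Φp K os) ∧ (∀ ω, |F K os ω| ≤ 1) ∧
    (∀ ω, |Φp K os ω| ≤ 1) ∧ 0 ≤ s K ∧ ∃ D : OldLayerDatum (P K) (F K os) (Φp K os), D.total ≤ C * s K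

/-- **NODE Q.old PRODUCED: the old-layer budget gives the pure-average L¹ rate** (`NE7LawLevelWindow.PureAverageL1Rate`),
hence `OldResamplingSmall` by `oldResamplingSmall_of_pureAverageL1Rate` and NODE Q's rate by
`NE7LawLevelAssembly.dressingMeanRate_of_split`. [folklore] -/
theorem pureAverageL1Rate_of_oldLayerBudget {Ω : ℕ → Type*} [∀ K, MeasurableSpace (Ω K)] {P : ∀ K, Measure (Ω K)}
    [∀ K, IsProbabilityMeasure (P K)] {F Φp : ∀ K, List O → Ω K → ℝ} {s : ℕ → ℝ}
    (h : OldLayerBudget Ω P F Φp s) : PureAverageL1Rate Ω P F Φp s := by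
  intro os
  obtain ⟨C, hC0, hC⟩ := h os
  refine ⟨C, hC0, fun K => ?_⟩
  obtain ⟨hFm, hΦm, hFb, hΦb, hs0, D, hD⟩ := hC K
  exact ⟨hFm, hΦm, hFb, hΦb, hs0, (integral_abs_sub_le_total hFm hΦm hFb hΦb D).trans hD⟩

end Producer

end Summit.QuantumFields.BalabanUV.T4Continuum.NE7LawLevel

end
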